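import Summits.PneNP.PneNP.Theses.UncheckableSAT
import Literature.Computability.Complexity.LundEtAl1992Proofs

/-!
# Route UncheckableSAT — `HonestFirstMessageCounts` (stmt-PneNP-2304)

"For LFKN itself the prover must count", in the tree's integer sumcheck: for `ψ` not mentioning `v` and
`φ = (v) ∧ (¬v) ∧ ψ`, the honest first polynomial satisfies `h_φ(2) = −2·#ψ`. Indeed `varList φ = v :: varList ψ`,
`h_φ(2) = H_φ([2]) = Σ_b P_φ(2, b)` (`eval_h`), the two unit clauses contribute `ρ(v) = 2` and `1 − ρ(v) = −1`, the
remaining factor is `P_ψ` at the point of `b` (which agrees with the point of `varList ψ` on the variables of `ψ`), and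
`Σ_b P_ψ(b) = H_ψ([]) = #ψ` (`LFKN.H_varList_nil_eq_numSat`).
-/

set_option linter.dupNamespace false -- `Summit.PneNP.PneNP.…`: summit = sub-problem name (D-0017 single-conjunct layout)

namespace Summit.PneNP.PneNP.Theorems

open Finset
open Literature.Computability.Complexity Literature.Computability.Complexity.Sumcheck

/-- The arithmetization of a CNF depends only on the values of the point at occurring variables. [folklore] -/
theorem cnfVal_congr_of_vars {R : Type*} [CommRing R] {ρ ρ' : ℕ → R} :
    ∀ {ψ : CNF ℕ}, (∀ w ∈ ψ.vars, ρ w = ρ' w) → cnfVal ρ ψ = cnfVal ρ' ψ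
  | [], _ => by simp
  | c :: ψ, h => by
    have hc : ∀ l ∈ c, ρ l.1 = ρ' l.1 := fun l hl =>
      h l.1 (by simp only [CNF.vars, List.mem_toFinset, List.mem_map, List.mem_flatten]; exact ⟨l, ⟨c, by simp, hl⟩, rfl⟩)
    have hψ : ∀ w ∈ CNF.vars ψ, ρ w = ρ' w := fun w hw => by
      refine h w ?_
      simp only [CNF.vars, List.mem_toFinset, List.mem_map, List.mem_flatten] at hw ⊢
      obtain ⟨l, ⟨c', hc', hl⟩, rfl⟩ := hw
      exact ⟨l, ⟨c', by simp [hc'], hl⟩, rfl⟩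
    rw [cnfVal_cons, cnfVal_cons, cnfVal_congr_of_vars hψ]
    congr 1
    simp only [clauseVal]
    congr 2
    refine List.map_congr_left fun l hl => ?_
    simp only [litVal, hc l hl]

/-- Folding `insertNew` from an accumulator that starts with a fresh variable. [folklore] -/
theorem foldl_insertNew_cons {v : ℕ} : ∀ (L acc : List ℕ), v ∉ L →
    L.foldl insertNew (v :: acc) = v :: L.foldl insertNew acc
  | [], acc, _ => rfl
  | w :: L, acc, h => by
    have hwv : w ≠ v := fun e => h (by simp [e])
    have hvL : v ∉ L := fun e => h (List.mem_cons_of_mem _ e)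
    have hstep : insertNew (v :: acc) w = v :: insertNew acc w := by
      simp only [insertNew, List.mem_cons, hwv, false_or]
      split_ifs <;> rfl
    rw [List.foldl_cons, List.foldl_cons, hstep, foldl_insertNew_cons L _ hvL]

/-- **Support item `HonestFirstMessageCounts` of route UncheckableSAT (stmt-PneNP-2304)**: for `ψ` not mentioning `v`,
the honest first sumcheck polynomial of `(v) ∧ (¬v) ∧ ψ` has `h(2) = −2 · #ψ`. [cite: AroraBarakCC2009, §8.3.2 ((8.7)–(8.9))]
[cite: LundEtAl1992, §3] -/
theorem uncheckableSAT_honestFirstMessageCounts_proof :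
    Summit.PneNP.PneNP.Theses.UncheckableSAT.HonestFirstMessageCounts := by
  unfold Summit.PneNP.PneNP.Theses.UncheckableSAT.HonestFirstMessageCounts
  intro ψ v hv
  classical
  -- the variable list
  have hvL : v ∉ ψ.flatten.map Prod.fst := fun h => hv (by
    simp only [CNF.vars, List.mem_toFinset]; exact h)
  have hvl : varList ([(v, true)] :: [(v, false)] :: ψ) = v :: varList ψ := by
    simp only [varList, List.flatten_cons, List.singleton_append, List.map_cons, List.foldl_cons]
    have h1 : insertNew [] v = [v] := by simp [insertNew]
    have h2 : insertNew [v] v = [v] := by simp [insertNew]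
    rw [h1, h2]
    exact foldl_insertNew_cons _ _ hvL
  rw [hvl, eval_h]
  -- unfold `H` at the prefix `[2]`
  unfold H cubeSum
  -- the value of `φ` at the point of `2 :: xs`
  have hpt_v : ∀ xs : List ℤ, pt (v :: varList ψ) (2 :: xs) v = 2 := fun xs => by
    simp [pt]
  have hpt_w : ∀ (xs : List ℤ), ∀ w ∈ ψ.vars, pt (v :: varList ψ) (2 :: xs) w = pt (varList ψ) xs w := by
    intro xs w hw
    have hwv : w ≠ v := fun e => hv (e ▸ hw)
    simp only [pt, List.idxOf_cons_ne _ hwv.symm, List.getD_cons_succ]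
  have hval : ∀ xs : List ℤ, cnfVal (pt (v :: varList ψ) (2 :: xs)) ([(v, true)] :: [(v, false)] :: ψ)
      = -2 * cnfVal (pt (varList ψ) xs) ψ := fun xs => by
    rw [cnfVal_cons, cnfVal_cons, cnfVal_congr_of_vars (hpt_w xs)]
    simp only [clauseVal, litVal, List.map_cons, List.map_nil, List.prod_cons, List.prod_nil, hpt_v, if_true,
      Bool.false_eq_true, if_false]
    ring
  show (∑ b : Fin (varList ψ).length → Bool,
      cnfVal (pt (v :: varList ψ) ([] ++ [2] ++ bits b)) ([(v, true)] :: [(v, false)] :: ψ)) = _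
  simp only [List.nil_append, List.singleton_append, hval, ← Finset.mul_sum]
  have hH := LFKN.H_varList_nil_eq_numSat ψ
  unfold H cubeSum at hH
  simp only [List.length_nil, Nat.sub_zero, List.nil_append] at hH
  rw [hH]

end Summit.PneNP.PneNP.Theorems
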